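import Summits.MatrixMultiplication.MatrixMultiplication.Theses.SaturationLadder
import Summits.MatrixMultiplication.MatrixMultiplication.Theorems.FarEdgeDescentGlue
import Literature.Computability.AlgebraicComplexity.RectangularExponentSubadditivity
import Literature.Computability.AlgebraicComplexity.RectangularExponentBounds
import HarnessLib

/-!
# SaturationLadder — the length ladder dominates the rate ladder, rung by rung;
# `PolyToFinite` (stmt-MatrixMultiplication-25911) is implied by `OctaveFlatness` (stmt-25348)

Route `SaturationLadder` grades the information-tight LENGTH `r(t) = inf {r ≥ 1 : ω(1,t,r) = 1 + r}` of the
thin shapes `⟨n, n^t, n^r⟩` as `t ↑ 1` (exponential / subexponential / polynomial / finite); route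
`FarEdgeDescent` grades the RATE at which the far excess `e(K) = ω(1,K,1) − (K+1)` tends to `0`
(`LogRate` / `SubLogRate` / `PowerAmortisation` / `FiniteSaturation`).  One inequality links them:

  `ω(1,t,r) ≤ 1 + r`  ⟹  `e(r) ≤ 1 − t`                                   (`farExcess_le_of_tight`)

(continuity of `ω` in the middle slot, Lotti–Romani 1983 §1), and `e` is non-increasing (`farExcess_anti`).
Inverting the length bound `r ≤ R(t)` at `t = 1 − ε(K)` with `R(1 − ε(K)) = K` gives `e(K) ≤ ε(K)`:

* `subLogRate_of_subexpSaturation`     : `SubexpSaturation` (stmt-25909) ⟹ `SubLogRate` (stmt-25371);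
* `powerAmortisation_of_polySaturation` : `PolySaturation` (stmt-25915) ⟹ `PowerAmortisation` (stmt-25347),
  with Hölder exponent `δ = 1/(k+1)` from length exponent `k`;
* `polyToFinite_of_octaveFlatness`      : `OctaveFlatness` (stmt-25348) ⟹ `PolyToFinite` (stmt-25911) — the
  ladder's third cone piece is DOMINATED by the far-edge route's rigidity law, through the landed split glue
  `FarEdgeDescentGlue.finiteSaturationGlue` (`PowerAmortisation → OctaveFlatness → FiniteSaturation`).

(The exponential rung gives only `e(K) ≤ log θ / log (K/C)`, weaker than the landed `LogRate`, and is omitted;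
the converse edges fail in the model worlds recorded in the two route files — a rate law never yields an exact
tight point.)  No named facts, no sorry (cell `decomp-mm`, lens 1 «grading / quantitative ladder», gen 11).
-/

set_option linter.dupNamespace false
-- (single-conjunct summit: the namespace repeats `MatrixMultiplication`)

noncomputable section

namespace Summit.MatrixMultiplication.MatrixMultiplication.Theorems.SaturationLadderRateCalibration

open Literature.Computability.AlgebraicComplexity
open Summit.MatrixMultiplication.MatrixMultiplication.Theses.SaturationLadder
  (SubexpSaturation PolySaturation PolyToFinite)
open Summit.MatrixMultiplication.MatrixMultiplication.Theses.FarEdgeDescent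
  (SubLogRate PowerAmortisation OctaveFlatness FiniteSaturation)
open Summit.MatrixMultiplication.MatrixMultiplication.Theorems.FarEdgeDescentGlue
  (finiteSaturationGlue)

/-! ## The far excess `e(K) = ω(1,K,1) − (K+1)` against tight points -/

/-- **A tight point bounds the far excess at its length**: `ω(1,t,r) ≤ 1 + r` and `t ≤ 1` give
`ω(1,r,1) − (r+1) ≤ 1 − t` (`ω(1,1,r) ≤ ω(1,t,r) + (1 − t)` and `ω(1,r,1) = ω(1,1,r)`).
[cite: LottiRomani1983, §1 (p. 173)] -/
theorem farExcess_le_of_tight {t r : ℝ} (ht : t ≤ 1) (h : omegaRect ℂ 1 t r ≤ 1 + r) :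
    omegaRect ℂ 1 r 1 - (r + 1) ≤ 1 - t := by
  have h1 := omegaRect_add_le_add_pos ℂ 1 t r 0 (1 - t) 0
  rw [add_zero, add_zero, show t + (1 - t) = 1 by ring, max_self,
    max_eq_left (by linarith : (0 : ℝ) ≤ 1 - t), zero_add, add_zero] at h1
  rw [omegaRect_one_mid_one]
  linarith

/-- **The far excess is non-increasing**: `K ≤ K'` gives `e(K') ≤ e(K)` (`ω(1,K',1) ≤ ω(1,K,1) + (K' − K)`).
[cite: LottiRomani1983, §1 (p. 173)] -/
theorem farExcess_anti {K K' : ℝ} (h : K ≤ K') :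
    omegaRect ℂ 1 K' 1 - (K' + 1) ≤ omegaRect ℂ 1 K 1 - (K + 1) := by
  have h1 := omegaRect_add_le_add_pos ℂ 1 K 1 0 (K' - K) 0
  rw [show K + (K' - K) = K' by ring, max_eq_left (by linarith : (0 : ℝ) ≤ K' - K)] at h1
  simp only [add_zero, zero_add, max_self] at h1
  linarith

/-- **The far excess is at most `1`** (`ω(1,K,1) ≤ ω(1,0,1) + K = 2 + K` for `K ≥ 0`).
[cite: LottiRomani1983, §1 (p. 173)] -/
theorem farExcess_le_one {K : ℝ} (hK : 0 ≤ K) : omegaRect ℂ 1 K 1 - (K + 1) ≤ 1 := by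
  have h1 := omegaRect_add_le_add_pos ℂ 1 0 1 0 K 0
  rw [max_eq_left hK] at h1
  simp only [add_zero, zero_add, max_self, omegaRect_one_zero_one] at h1
  linarith

/-! ## Subexponential length ⟹ sub-logarithmic rate -/

/-- **`SubexpSaturation → SubLogRate`**: if for every `c > 0` the tight length is eventually
`≤ exp(c/(1−t))`, then for every `c > 0` eventually `e(k) ≤ c / log k` (take `t = 1 − c/log k`, so that
`exp(c/(1−t)) = k`).  [cite: LottiRomani1983, §1 (p. 173)] [cite: CoppersmithWinograd1990, §8] -/
theorem subLogRate_of_subexpSaturation (h : SubexpSaturation) : SubLogRate := by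
  intro c hc
  obtain ⟨t₀, ht₀, H⟩ := h c hc
  -- threshold: `log k ≥ c/(1 − t₀)` and `k ≥ 2`
  obtain ⟨k₁, hk₁⟩ := exists_nat_ge (Real.exp (c / (1 - t₀)))
  refine ⟨max 2 k₁, le_max_left _ _, fun k hk => ?_⟩
  have hk2 : (2 : ℝ) ≤ k := by exact_mod_cast (le_max_left 2 k₁).trans hk
  have hkk₁ : (k₁ : ℝ) ≤ k := by exact_mod_cast (le_max_right 2 k₁).trans hk
  have hkpos : (0 : ℝ) < k := by linarith
  have hlog : 0 < Real.log k := Real.log_pos (by linarith)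
  -- `log k ≥ c/(1−t₀)`
  have h1t₀ : 0 < 1 - t₀ := by linarith
  have hlogk : c / (1 - t₀) ≤ Real.log k := by
    have := Real.log_le_log (Real.exp_pos _) (hk₁.trans hkk₁)
    rwa [Real.log_exp] at this
  -- the abscissa `t = 1 − c / log k`
  set t : ℝ := 1 - c / Real.log k with ht_def
  have hct : 1 - t = c / Real.log k := by rw [ht_def]; ring
  have ht1 : t < 1 := by
    have : 0 < c / Real.log k := div_pos hc hlog
    linarith
  have ht₀t : t₀ ≤ t := by
    -- `c / log k ≤ 1 − t₀`
    have : c / Real.log k ≤ 1 - t₀ := by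
      rw [div_le_iff₀ hlog]
      have := (div_le_iff₀ h1t₀).1 hlogk
      linarith
    linarith
  obtain ⟨r, hr1, hrexp, hT⟩ := H t ht₀t ht1
  -- `exp(c/(1−t)) = k`
  have hexp : Real.exp (c / (1 - t)) = k := by
    rw [hct, div_div_cancel₀ hc.ne', Real.exp_log hkpos]
  rw [hexp] at hrexp
  -- `e(k) ≤ e(r) ≤ 1 − t = c / log k`
  have h1 := farExcess_le_of_tight ht1.le hT
  have h2 := farExcess_anti hrexp
  rw [hct] at h1
  linarith

/-! ## Polynomial length ⟹ power rate -/

/-- **`PolySaturation → PowerAmortisation`** (Hölder exponent `δ = 1/(k+1)`, constant `C^δ`): for an integer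
`K ≥ 1`, if `K ≤ C` then `e(K) ≤ 1 ≤ (C/K)^δ`; else take `t = 1 − (C/K)^δ ∈ [0,1)`, whose tight length is
`r ≤ C (1−t)^{−k} = K · (C/K)^δ ≤ K`, so `e(K) ≤ e(r) ≤ 1 − t = C^δ K^{−δ}`.
[cite: LottiRomani1983, §1 (p. 173)] [cite: HuangPan1998, (2.8)] -/
theorem powerAmortisation_of_polySaturation (h : PolySaturation) : PowerAmortisation := by
  obtain ⟨C, k, H⟩ := h
  -- `C ≥ 1` from the point at `t = 0`
  obtain ⟨r₀, hr₀, hr₀C, -⟩ := H 0 le_rfl one_pos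
  have hC1 : 1 ≤ C := by
    have : C * ((1 - (0 : ℝ))⁻¹) ^ k = C := by simp
    linarith [this ▸ hr₀C]
  have hC0 : 0 < C := by linarith
  set δ : ℝ := 1 / ((k : ℝ) + 1) with hδ_def
  have hk1 : (0 : ℝ) < (k : ℝ) + 1 := by positivity
  have hδ0 : 0 < δ := by positivity
  refine ⟨δ, C ^ δ, hδ0, fun K hK => ?_⟩
  have hK1 : (1 : ℝ) ≤ K := by exact_mod_cast hK
  have hK0 : (0 : ℝ) < K := by linarith
  -- the target scale `s = (K/C)^{−δ} = C^δ · K^{−δ}`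
  set s : ℝ := ((K : ℝ) / C) ^ (-δ) with hs_def
  have hs_eq : s = C ^ δ * (K : ℝ) ^ (-δ) := by
    rw [hs_def, Real.div_rpow hK0.le hC0.le, Real.rpow_neg hC0.le, div_inv_eq_mul, mul_comm]
  have hs0 : 0 < s := Real.rpow_pos_of_pos (div_pos hK0 hC0) _
  rw [← hs_eq]
  by_cases hKC : (K : ℝ) ≤ C
  · -- `s ≥ 1 ≥ e(K)`
    have hs1 : 1 ≤ s :=
      Real.one_le_rpow_of_pos_of_le_one_of_nonpos (div_pos hK0 hC0)
        ((div_le_one hC0).2 hKC) (by linarith)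
    exact (farExcess_le_one hK0.le).trans hs1
  · push Not at hKC
    -- `s ≤ 1`
    have hs1 : s ≤ 1 :=
      Real.rpow_le_one_of_one_le_of_nonpos ((one_le_div hC0).2 hKC.le) (by linarith)
    -- the abscissa `t = 1 − s`
    obtain ⟨r, hr1, hrC, hT⟩ := H (1 - s) (by linarith) (by linarith)
    -- `C · ((1 − (1 − s))⁻¹)^k = C · s^{−k} = K · s ≤ K`
    have hkey : C * ((1 - (1 - s))⁻¹) ^ k = K * s := by
      have e1 : (1 - (1 - s))⁻¹ = ((K : ℝ) / C) ^ δ := by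
        rw [sub_sub_cancel, hs_def, Real.rpow_neg (div_pos hK0 hC0).le, inv_inv]
      rw [e1, ← Real.rpow_natCast, ← Real.rpow_mul (div_pos hK0 hC0).le]
      have e2 : δ * (k : ℝ) = 1 + (-δ) := by
        rw [hδ_def]; field_simp; ring
      rw [e2, Real.rpow_add (div_pos hK0 hC0), Real.rpow_one, ← hs_def]
      field_simp
    rw [hkey] at hrC
    have hrK : r ≤ K := hrC.trans (by nlinarith)
    have h1 := farExcess_le_of_tight (by linarith : 1 - s ≤ 1) hT
    have h2 := farExcess_anti hrK
    rw [sub_sub_cancel] at h1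
    linarith

/-! ## The third cone piece is dominated by octave flatness -/

/-- **`OctaveFlatness → PolyToFinite`** (stmt-25348 ⟹ stmt-25911): polynomial length gives power
amortisation (`powerAmortisation_of_polySaturation`), and power amortisation with octave flatness gives a
finite tight onset (the landed split glue `finiteSaturationGlue`).
[cite: LottiRomani1983, §1 (p. 173)] [cite: HuangPan1998, (2.8)] -/
theorem polyToFinite_of_octaveFlatness (hO : OctaveFlatness) : PolyToFinite :=
  fun hP => finiteSaturationGlue (powerAmortisation_of_polySaturation hP) hO

/-- Consequent truth: `FiniteSaturation → PolyToFinite`. [folklore] -/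
theorem polyToFinite_of_finiteSaturation (hF : FiniteSaturation) : PolyToFinite := fun _ => hF

end Summit.MatrixMultiplication.MatrixMultiplication.Theorems.SaturationLadderRateCalibration

end
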